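import Mathlib
import Literature.Barriers.ValiantsHypothesis.NotViaSaturationsChowProofs
import Literature.Computability.AlgebraicComplexity.OrbitClosureProofs
import Literature.Computability.AlgebraicComplexity.OrbitCoordinateRingProofs
import Literature.NumberTheory.DiophantineGeometry.SchurWeylPlethysmOrbitWeightsProofs

/-!
# `GeneratorObstructions.GenInheritance` (stmt-ValiantsHypothesis-11659) — helper file 1:
pull-back of indecomposable highest-weight vectors, block extension of matrices, transport
between conjugate placements

Support lemmas for the inheritance theorem for GENERATOR TYPES of the algebra of highest-weight
vectors `A(f) = ⊕_χ HWV_χ(k[Δ_m[f]])` of the coordinate ring of an orbit closure (the route's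
`γ_χ(f) = dim HWV_χ / (HWV_χ ∩ Σ_{χ₁+χ₂=χ, χᵢ≠0} HWV_χ₁·HWV_χ₂)`), proved in the sibling files
`GeneratorObstructionsGenInheritanceUpper.lean` / `GeneratorObstructionsGenInheritance.lean`:

* §1 `finrank_quotient_comap_subtype_ne_zero_iff`, `not_le_decomposable_of_map_eq`: abstract
  bookkeeping — along an injective algebra map `Φ : A → A'` equivariant enough to carry `HWV_χ(A)`
  onto `HWV_{ext χ}(A')` for an additive injective `ext` on weights, with every occurring splitting
  of `ext χ` coming from `σ`, indecomposability of highest-weight vectors pulls back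
  (`Submodule.map_mul` and injectivity);
* §2 block-diagonal extension `Mat_σ → Mat_τ` along an injection of letters `ι` (as an existence
  statement, no definitions), extension of upper triangular elements of `GL`, the commutation
  rules `ι(M · p) = M̃ · ι(p)` and `killCompl ι (N · ι p) = N|_{ι×ι} · p`, whence over an infinite
  field `ι(GL_σ · f) ⊆ Δ[ι f]` and `F ∈ I(GL_σ · f) ↔ rename F ∈ I(GL_τ · ι f)`
  (Mulmuley–Sohoni 2001 §4, `End · f ⊆ Δ[f]`; BHI 2017 §1 (2));
* §3 `γ_χ ≠ 0` only depends on the vanishing ideal (`Ideal.quotientEquivAlgOfEq` is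
  `GL`-equivariant), and two injective placements `κ, ι : σ → τ` of the letters give forms in one
  `GL_τ`-orbit (permutation matrices, `linSubst_permMatrix`).

All statements are elementary; no new definitions. [folklore]
-/

namespace Summit.ValiantsHypothesis.ValiantsHypothesis.Theorems.GenInheritance

open MvPolynomial
open Literature.NumberTheory.DiophantineGeometry Literature.Computability.AlgebraicComplexity
  Literature.Computability.Complexity Literature.Barriers.ValiantsHypothesis

-- `Summit.ValiantsHypothesis.ValiantsHypothesis.…` is the tree's mandated single-conjunct layout (Sub = Summit).
set_option linter.dupNamespace false

section Finrank

variable {K V : Type*} [Field K] [AddCommGroup V] [Module K V]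

/-- For a finite-dimensional subspace `S` and any subspace `D`, the quotient `S ⧸ (S ∩ D)` has
nonzero dimension iff `S ⊄ D`. [folklore] -/
theorem finrank_quotient_comap_subtype_ne_zero_iff (S D : Submodule K V) [FiniteDimensional K S] :
    Module.finrank K (S ⧸ D.comap S.subtype) ≠ 0 ↔ ¬ S ≤ D := by
  rw [Ne, Module.finrank_zero_iff, Submodule.Quotient.subsingleton_iff, Submodule.comap_subtype_eq_top]

end Finrank

section Pullback

variable {k : Type*} [Field k] {σ τ : Type*} [Fintype σ] [LinearOrder σ] [Fintype τ] [LinearOrder τ]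
  {A A' : Type*} [CommRing A] [Algebra k A] [CommRing A'] [Algebra k A']

/-- **Pull-back of indecomposability.** Let `ρ`, `ρ'` be representations of `GL_σ`, `GL_τ` on
commutative `k`-algebras `A`, `A'`, `Φ : A →ₐ[k] A'` injective, `ext` an injective additive map on
weights with `Φ(HWV_χ(A)) = HWV_{ext χ}(A')` for all `χ`, and suppose every weight `ψ₁` of `τ` with
`HWV_ψ₁(A') ≠ 0` that splits `ext χ = ψ₁ + ψ₂` with `HWV_ψ₂(A') ≠ 0` lies in the range of `ext`. If
`HWV_χ(A)` is not contained in `Σ_{χ₁+χ₂=χ, χᵢ≠0} HWV_χ₁(A)·HWV_χ₂(A)`, then `HWV_{ext χ}(A')` is not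
contained in `Σ_{ψ₁+ψ₂=ext χ, ψᵢ≠0} HWV_ψ₁(A')·HWV_ψ₂(A')`. [folklore] -/
theorem not_le_decomposable_of_map_eq
    (ρ : Representation k (GL σ k) A) (ρ' : Representation k (GL τ k) A')
    (Φ : A →ₐ[k] A') (hΦ : Function.Injective Φ)
    (ext : Weight σ → Weight τ) (hadd : ∀ a b, ext (a + b) = ext a + ext b)
    (hinj : Function.Injective ext)
    (H1 : ∀ χ : Weight σ, (highestWeightSpace ρ χ).map Φ.toLinearMap = highestWeightSpace ρ' (ext χ))
    (χ : Weight σ)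
    (H2 : ∀ ψ₁ ψ₂ : Weight τ, ψ₁ + ψ₂ = ext χ → highestWeightSpace ρ' ψ₁ ≠ ⊥ →
      highestWeightSpace ρ' ψ₂ ≠ ⊥ → ∃ χ₁, ext χ₁ = ψ₁)
    (h : ¬ highestWeightSpace ρ χ ≤ ⨆ p : Weight σ × Weight σ,
      ⨆ (_ : p.1 + p.2 = χ ∧ p.1 ≠ 0 ∧ p.2 ≠ 0), highestWeightSpace ρ p.1 * highestWeightSpace ρ p.2) :
    ¬ highestWeightSpace ρ' (ext χ) ≤ ⨆ p : Weight τ × Weight τ,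
      ⨆ (_ : p.1 + p.2 = ext χ ∧ p.1 ≠ 0 ∧ p.2 ≠ 0),
        highestWeightSpace ρ' p.1 * highestWeightSpace ρ' p.2 := by
  intro hle
  apply h
  intro v hv
  -- `ext 0 = 0`
  have hext0 : ext 0 = 0 := by
    have h00 := hadd 0 0
    rw [add_zero] at h00
    exact left_eq_add.mp h00
  -- the decomposable part of `A'` at `ext χ` is the image of the decomposable part of `A` at `χ`
  have hDle : (⨆ p : Weight τ × Weight τ, ⨆ (_ : p.1 + p.2 = ext χ ∧ p.1 ≠ 0 ∧ p.2 ≠ 0),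
      highestWeightSpace ρ' p.1 * highestWeightSpace ρ' p.2) ≤
      (⨆ p : Weight σ × Weight σ, ⨆ (_ : p.1 + p.2 = χ ∧ p.1 ≠ 0 ∧ p.2 ≠ 0),
        highestWeightSpace ρ p.1 * highestWeightSpace ρ p.2).map Φ.toLinearMap := by
    refine iSup_le fun p => iSup_le fun hp => ?_
    obtain ⟨hsum, hp1, hp2⟩ := hp
    by_cases hb1 : highestWeightSpace ρ' p.1 = ⊥
    · rw [hb1, Submodule.bot_mul]; exact bot_le
    by_cases hb2 : highestWeightSpace ρ' p.2 = ⊥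
    · rw [hb2, Submodule.mul_bot]; exact bot_le
    obtain ⟨χ₁, hχ₁⟩ := H2 p.1 p.2 hsum hb1 hb2
    obtain ⟨χ₂, hχ₂⟩ := H2 p.2 p.1 ((add_comm _ _).trans hsum) hb2 hb1
    have hχ : χ₁ + χ₂ = χ := hinj (by rw [hadd, hχ₁, hχ₂, hsum])
    have hχ₁0 : χ₁ ≠ 0 := fun h0 => hp1 (by rw [← hχ₁, h0, hext0])
    have hχ₂0 : χ₂ ≠ 0 := fun h0 => hp2 (by rw [← hχ₂, h0, hext0])
    rw [← hχ₁, ← hχ₂, ← H1 χ₁, ← H1 χ₂, ← Submodule.map_mul]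
    refine Submodule.map_mono ?_
    exact le_iSup_of_le (χ₁, χ₂) (le_iSup_of_le ⟨hχ, hχ₁0, hχ₂0⟩ le_rfl)
  -- `Φ v` is decomposable, hence `v` is
  have hΦv : Φ v ∈ highestWeightSpace ρ' (ext χ) := by
    rw [← H1 χ]
    exact Submodule.mem_map_of_mem hv
  obtain ⟨w, hw, hwv⟩ := Submodule.mem_map.mp (hDle (hle hΦv))
  have hwv' : w = v := hΦ hwv
  rw [← hwv']
  exact hw

end Pullback


section BlockExtAll

variable {k : Type*} [Field k] {σ τ : Type*} [Fintype σ] [LinearOrder σ] [Fintype τ] [LinearOrder τ]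
  {ι : σ → τ}

section Extend

/-- **Block-diagonal extension of matrices along an injection of letters.** There is a monoid
homomorphism `E : Mat_σ → Mat_τ` with `E(M)_{ι i, ι j} = M_{i j}` and `E(M)_{y x} = δ_{y x}`
whenever `y` or `x` lies off the range of `ι` (the matrix `diag(M, 1)` in a basis adapted to
`τ = ι(σ) ⊔ rest`). [folklore] -/
theorem exists_monoidHom_matrix_extend (hι : Function.Injective ι) :
    ∃ E : Matrix σ σ k →* Matrix τ τ k,
      (∀ M i j, E M (ι i) (ι j) = M i j) ∧
      (∀ M y x, (y ∉ Set.range ι ∨ x ∉ Set.range ι) → E M y x = (1 : Matrix τ τ k) y x) := by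
  classical
  -- preimage of a letter of the range
  let pre : ∀ y : τ, y ∈ Set.range ι → σ := fun y hy => (Equiv.ofInjective ι hι).symm ⟨y, hy⟩
  have hpre : ∀ i (h : ι i ∈ Set.range ι), pre (ι i) h = i := fun i h =>
    Equiv.ofInjective_symm_apply hι i
  have hιpre : ∀ y (hy : y ∈ Set.range ι), ι (pre y hy) = y := by
    rintro _ ⟨i, rfl⟩
    rw [hpre]
  obtain ⟨E, hE⟩ : ∃ E : Matrix σ σ k → Matrix τ τ k, ∀ M y x, E M y x =
      if h : y ∈ Set.range ι ∧ x ∈ Set.range ι then M (pre y h.1) (pre x h.2)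
      else (1 : Matrix τ τ k) y x :=
    ⟨fun M => Matrix.of fun y x => if h : y ∈ Set.range ι ∧ x ∈ Set.range ι then
      M (pre y h.1) (pre x h.2) else (1 : Matrix τ τ k) y x, fun M y x => rfl⟩
  have hEin : ∀ M i j, E M (ι i) (ι j) = M i j := by
    intro M i j
    rw [hE, dif_pos (And.intro (Set.mem_range_self i) (Set.mem_range_self j)), hpre, hpre]
  have hEout : ∀ M y x, (y ∉ Set.range ι ∨ x ∉ Set.range ι) → E M y x = (1 : Matrix τ τ k) y x := by
    intro M y x h
    rw [hE, dif_neg]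
    exact fun ⟨hy, hx⟩ => h.elim (fun h => h hy) (fun h => h hx)
  have hone : E 1 = 1 := by
    ext y x
    by_cases h : y ∈ Set.range ι ∧ x ∈ Set.range ι
    · obtain ⟨⟨i, rfl⟩, ⟨j, rfl⟩⟩ := h
      rw [hEin, Matrix.one_apply, Matrix.one_apply]
      simp only [hι.eq_iff]
    · rw [hEout _ _ _ (not_and_or.mp h)]
  have hmul : ∀ M N, E (M * N) = E M * E N := by
    intro M N
    ext y x
    rw [Matrix.mul_apply]
    by_cases hy : y ∈ Set.range ι
    · obtain ⟨i, rfl⟩ := hy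
      -- the summand vanishes off the range
      rw [sum_eq_sum_app hι (fun z => E M (ι i) z * E N z x) fun z hz => by
        rw [hEout _ _ _ (Or.inr hz), Matrix.one_apply, if_neg (fun h => hz ⟨i, h⟩), zero_mul]]
      rw [Finset.sum_congr rfl fun l _ => by rw [hEin]]
      by_cases hx : x ∈ Set.range ι
      · obtain ⟨j, rfl⟩ := hx
        rw [hEin, Matrix.mul_apply]
        exact Finset.sum_congr rfl fun l _ => by rw [hEin]
      · rw [hEout _ _ _ (Or.inr hx), Matrix.one_apply, if_neg (fun h => hx ⟨i, h⟩)]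
        exact (Finset.sum_eq_zero fun l _ => by
          rw [hEout _ _ _ (Or.inr hx), Matrix.one_apply, if_neg (fun h => hx ⟨l, h⟩), mul_zero]).symm
    · rw [Finset.sum_eq_single y (fun z _ hz => by
          rw [hEout M _ _ (Or.inl hy), Matrix.one_apply, if_neg (Ne.symm hz), zero_mul])
        (fun h => absurd (Finset.mem_univ y) h),
        hEout M _ _ (Or.inl hy), Matrix.one_apply, if_pos rfl, one_mul,
        hEout (M * N) _ _ (Or.inl hy), hEout N _ _ (Or.inl hy)]
  exact ⟨⟨⟨E, hone⟩, hmul⟩, hEin, hEout⟩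

end Extend

section Upper

/-- **Extension of upper triangular invertible matrices.** For a strictly monotone `ι`, every
upper triangular `b ∈ GL_σ` is the `σ`-block of an upper triangular `c ∈ GL_τ` (its block-diagonal
extension by the identity). [folklore] -/
theorem exists_gl_isUpperTriangular_extend (hι : StrictMono ι) (b : GL σ k)
    (hb : IsUpperTriangular b) :
    ∃ c : GL τ k, IsUpperTriangular c ∧
      (∀ i j, (c : Matrix τ τ k) (ι i) (ι j) = (b : Matrix σ σ k) i j) ∧
      (∀ y x, (y ∉ Set.range ι ∨ x ∉ Set.range ι) → (c : Matrix τ τ k) y x = (1 : Matrix τ τ k) y x) := by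
  obtain ⟨E, hEin, hEout⟩ := exists_monoidHom_matrix_extend (k := k) hι.injective
  refine ⟨Units.map E b, ?_, fun i j => hEin _ i j, fun y x h => hEout _ y x h⟩
  intro y x hxy
  change E (b : Matrix σ σ k) y x = 0
  by_cases h : y ∈ Set.range ι ∧ x ∈ Set.range ι
  · obtain ⟨⟨i, rfl⟩, ⟨j, rfl⟩⟩ := h
    rw [hEin]
    exact hb.apply_eq_zero (hι.lt_iff_lt.mp hxy)
  · rw [hEout _ _ _ (not_and_or.mp h), Matrix.one_apply, if_neg (show y ≠ x from ne_of_gt hxy)]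

/-- The `σ`-block (`upperBlock`) of an extension `c` of `b` is `b`. [folklore] -/
theorem upperBlock_eq_of_extend (hι : StrictMono ι) (hup : IsUpperSet (Set.range ι)) {b : GL σ k}
    {c : GL τ k} (hc : IsUpperTriangular c)
    (hcb : ∀ i j, (c : Matrix τ τ k) (ι i) (ι j) = (b : Matrix σ σ k) i j) :
    upperBlock hι hup c hc = b := by
  refine Units.ext (Matrix.ext fun i j => ?_)
  rw [upperBlock_apply, hcb]

end Upper

section Rename

omit [LinearOrder σ] [LinearOrder τ] in
/-- **Renaming intertwines substitutions**: if `N` agrees with `M` on the `ι`-block and vanishes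
below it in the `ι`-columns (`N_{y, ι j} = 0` for `y ∉ range ι`), then
`rename ι (M · p) = N · rename ι p`. [folklore] -/
theorem rename_linSubst_eq (hι : Function.Injective ι) (M : Matrix σ σ k) (N : Matrix τ τ k)
    (hin : ∀ i j, N (ι i) (ι j) = M i j) (hout : ∀ y j, y ∉ Set.range ι → N y (ι j) = 0)
    (p : MvPolynomial σ k) :
    rename ι (linSubst σ k M p) = linSubst τ k N (rename ι p) := by
  suffices H : (rename ι).comp (linSubst σ k M) = (linSubst τ k N).comp (rename (R := k) ι) from
    congrArg (fun φ => φ p) H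
  apply MvPolynomial.algHom_ext
  intro j
  simp only [AlgHom.comp_apply, rename_X, linSubst_X, map_sum, map_smul]
  rw [sum_eq_sum_app hι (fun y => N y (ι j) • (X y : MvPolynomial τ k)) fun y hy => by
    rw [hout y j hy, zero_smul]]
  simp only [hin]

omit [LinearOrder σ] [LinearOrder τ] in
/-- **Killing the letters off the range after substituting into a renamed polynomial is
substituting the block**: `killCompl ι (N · rename ι p) = N|_{ι×ι} · p` for every matrix `N`.
[folklore] -/
theorem killCompl_linSubst_rename (hι : Function.Injective ι) (N : Matrix τ τ k)
    (p : MvPolynomial σ k) :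
    killCompl hι (linSubst τ k N (rename ι p)) = linSubst σ k (N.submatrix ι ι) p := by
  suffices H : (killCompl hι).comp ((linSubst τ k N).comp (rename (R := k) ι)) =
      linSubst σ k (N.submatrix ι ι) from congrArg (fun φ => φ p) H
  apply MvPolynomial.algHom_ext
  intro j
  simp only [AlgHom.comp_apply, rename_X, linSubst_X, map_sum, map_smul]
  rw [sum_eq_sum_app hι (fun y => N y (ι j) • killCompl (R := k) hι (X y)) fun y hy => by
    rw [killCompl_X_of_not_mem hι hy, smul_zero]]
  simp only [killCompl_X_app, Matrix.submatrix_apply]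

variable [Infinite k]

/-- **The renamed orbit lies in the orbit closure of the renamed form**: over an infinite field,
`ι(g · f) ∈ Δ[ι(f)]` for every `g ∈ GL_σ` (it is `diag(g, 1) · ι(f)`, a point of the
endomorphism orbit, `endOrbit_subset_orbitClosure_holds`). Mulmuley–Sohoni 2001 §4. [folklore] -/
theorem rename_linSubstRep_mem_orbitClosure (hι : Function.Injective ι) (f : MvPolynomial σ k)
    (g : GL σ k) : rename ι (linSubstRep σ k g f) ∈ orbitClosure (rename ι f) := by
  obtain ⟨E, hEin, hEout⟩ := exists_monoidHom_matrix_extend (k := k) hι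
  rw [linSubstRep_apply, rename_linSubst_eq hι (g : Matrix σ σ k) (E (g : Matrix σ σ k))
    (hEin _) (fun y j hy => by
      rw [hEout _ _ _ (Or.inl hy), Matrix.one_apply, if_neg (fun h => hy ⟨j, h.symm⟩)]) f]
  exact endOrbit_subset_orbitClosure_holds _ ⟨_, rfl⟩

/-- **The vanishing ideal renames into the vanishing ideal**: for a nonzero form `f` of degree `m`
over an infinite field, if `F` vanishes on `GL_σ · f` then `F` renamed along `degIdxMap ι` vanishes
on `GL_τ · ι(f)`: at the point `h · ι(f)` it takes the value of `F` at `h|_{ι×ι} · f ∈ End · f ⊆ Δ[f]`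
(`killCompl_linSubst_rename`, `mem_orbitClosure_iff_formCoeff_holds`). [folklore] -/
theorem rename_mem_orbitVanishingIdeal (hι : Function.Injective ι) {f : MvPolynomial σ k} {m : ℕ}
    (hf : f.IsHomogeneous m) (hf0 : f ≠ 0) {F : MvPolynomial (DegIdx σ m) k}
    (hF : F ∈ orbitVanishingIdeal f m) :
    rename (degIdxMap hι) F ∈ orbitVanishingIdeal (rename ι f) m := by
  rw [mem_orbitVanishingIdeal_iff]
  intro h
  rw [aeval_rename]
  have hfun : formCoeff m (linSubstRep τ k h (rename ι f)) ∘ degIdxMap hι =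
      formCoeff m (linSubst σ k ((h : Matrix τ τ k).submatrix ι ι) f) := by
    funext d
    rw [Function.comp_apply, formCoeff_apply, formCoeff_apply, degIdxMap_val,
      ← coeff_killCompl hι, linSubstRep_apply, killCompl_linSubst_rename]
  rw [hfun]
  have hmem : linSubst σ k ((h : Matrix τ τ k).submatrix ι ι) f ∈ orbitClosure f :=
    endOrbit_subset_orbitClosure_holds _ ⟨_, rfl⟩
  have hz := ((mem_orbitClosure_iff_formCoeff_holds hf hf0).mp hmem).2
  rw [MvPolynomial.mem_zeroLocus_iff] at hz
  exact hz F hF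

/-- The two directions together: `F ∈ I(GL_σ · f) ↔ rename F ∈ I(GL_τ · ι(f))` for a nonzero form
`f` of degree `m` over an infinite field (`⇐` is the tree's `rename_not_mem_orbitVanishingIdeal`
with `rename_linSubstRep_mem_orbitClosure`). [folklore] -/
theorem rename_mem_orbitVanishingIdeal_iff (hι : Function.Injective ι) {f : MvPolynomial σ k}
    {m : ℕ} (hf : f.IsHomogeneous m) (hf0 : f ≠ 0) (F : MvPolynomial (DegIdx σ m) k) :
    rename (degIdxMap hι) F ∈ orbitVanishingIdeal (rename ι f) m ↔ F ∈ orbitVanishingIdeal f m := by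
  refine ⟨fun h => ?_, rename_mem_orbitVanishingIdeal hι hf hf0⟩
  by_contra hF
  exact rename_not_mem_orbitVanishingIdeal hι (hf.rename_isHomogeneous)
    ((map_ne_zero_iff _ (rename_injective ι hι)).mpr hf0)
    (rename_linSubstRep_mem_orbitClosure hι f) hF h

end Rename


end BlockExtAll

section Transport

variable {k : Type*} [Field k] {σ τ : Type*} [Fintype σ] [LinearOrder σ] [Fintype τ] [LinearOrder τ]
  {m : ℕ}

omit [LinearOrder τ] in
/-- Forms in the same `GL`-orbit have the same orbit, hence the same vanishing ideal (and
literally the same coordinate ring of the orbit closure). Mulmuley–Sohoni 2001 §4. [folklore] -/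
theorem orbitVanishingIdeal_eq_of_mem_glOrbit [DecidableEq τ] {f₁ f₂ : MvPolynomial τ k}
    (h : f₂ ∈ glOrbit τ k f₁) (m : ℕ) : orbitVanishingIdeal f₁ m = orbitVanishingIdeal f₂ m := by
  unfold orbitVanishingIdeal
  rw [glOrbit_eq_of_mem h]

/-- **`γ_χ` only depends on the vanishing ideal**: if two forms have the same vanishing ideal
(e.g. they lie in one `GL`-orbit), the canonical algebra isomorphism of the coordinate rings
(`Ideal.quotientEquivAlgOfEq`) is `GL`-equivariant, so `γ_χ ≠ 0` transfers. [folklore] -/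
theorem finrank_ne_zero_of_orbitVanishingIdeal_eq [Infinite k] {f₁ f₂ : MvPolynomial τ k}
    (hI : orbitVanishingIdeal f₁ m = orbitVanishingIdeal f₂ m) (hm : m ≠ 0) (χ : Weight τ)
    (h : Module.finrank k (↥(highestWeightSpace (orbitCoordRep f₁ m) χ) ⧸
      Submodule.comap (highestWeightSpace (orbitCoordRep f₁ m) χ).subtype
        (⨆ p : Weight τ × Weight τ, ⨆ (_ : p.1 + p.2 = χ ∧ p.1 ≠ 0 ∧ p.2 ≠ 0),
          highestWeightSpace (orbitCoordRep f₁ m) p.1 *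
            highestWeightSpace (orbitCoordRep f₁ m) p.2)) ≠ 0) :
    Module.finrank k (↥(highestWeightSpace (orbitCoordRep f₂ m) χ) ⧸
      Submodule.comap (highestWeightSpace (orbitCoordRep f₂ m) χ).subtype
        (⨆ p : Weight τ × Weight τ, ⨆ (_ : p.1 + p.2 = χ ∧ p.1 ≠ 0 ∧ p.2 ≠ 0),
          highestWeightSpace (orbitCoordRep f₂ m) p.1 *
            highestWeightSpace (orbitCoordRep f₂ m) p.2)) ≠ 0 := by
  haveI := finiteDimensional_highestWeightSpace_orbitCoordRep_holds f₁ hm χ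
  haveI := finiteDimensional_highestWeightSpace_orbitCoordRep_holds f₂ hm χ
  rw [finrank_quotient_comap_subtype_ne_zero_iff] at h ⊢
  set Φ := Ideal.quotientEquivAlgOfEq k hI with hΦdef
  have hΦ : ∀ F, Φ (Ideal.Quotient.mk _ F) = Ideal.Quotient.mk _ F := fun F =>
    Ideal.quotientEquivAlgOfEq_mk k hI F
  -- equivariance of `Φ`
  have hequiv : ∀ (g : GL τ k) (x : OrbitCoordRing f₁ m),
      orbitCoordRep f₂ m g (Φ x) = Φ (orbitCoordRep f₁ m g x) := by
    intro g x
    obtain ⟨F, rfl⟩ := Ideal.Quotient.mk_surjective x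
    rw [hΦ, orbitCoordRep_apply, orbitCoordSubst_mk, orbitCoordRep_apply, orbitCoordSubst_mk, hΦ]
  refine not_le_decomposable_of_map_eq (orbitCoordRep f₁ m) (orbitCoordRep f₂ m) Φ.toAlgHom
    Φ.injective id (fun _ _ => rfl) Function.injective_id (fun χ' => ?_) χ
    (fun ψ₁ _ _ _ _ => ⟨ψ₁, rfl⟩) h
  apply le_antisymm
  · rintro _ ⟨x, hx, rfl⟩ b hb
    change orbitCoordRep f₂ m b (Φ x) = _ • Φ x
    rw [hequiv, hx b hb, map_smul]
    rfl
  · intro y hy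
    refine ⟨Φ.symm y, fun b hb => Φ.injective ?_, Φ.apply_symm_apply y⟩
    rw [← hequiv, AlgEquiv.apply_symm_apply, hy b hb, map_smul, AlgEquiv.apply_symm_apply]
    rfl

omit [LinearOrder σ] [LinearOrder τ] in
/-- **Two placements of the same letters are conjugate by a permutation matrix**: for injections
`κ, ι : σ → τ`, `rename κ p` lies in the `GL_τ`-orbit of `rename ι p` (a permutation `π` of `τ`
with `π ∘ ι = κ` exists, `Equiv.extendSubtype`, and renaming by `π` is the substitution by a
permutation matrix, `linSubst_permMatrix`). [folklore] -/
theorem rename_mem_glOrbit_rename_of_injective [DecidableEq τ] (κ ι : σ → τ)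
    (hκ : Function.Injective κ) (hι : Function.Injective ι) (p : MvPolynomial σ k) :
    rename κ p ∈ glOrbit τ k (rename ι p) := by
  classical
  let e : {x // x ∈ Set.range ι} ≃ {x // x ∈ Set.range κ} :=
    (Equiv.ofInjective ι hι).symm.trans (Equiv.ofInjective κ hκ)
  let π : Equiv.Perm τ := e.extendSubtype
  have hπ : ∀ i, π (ι i) = κ i := fun i => by
    have h1 := Equiv.extendSubtype_apply_of_mem e (ι i) ⟨i, rfl⟩
    rw [h1]
    change ((Equiv.ofInjective κ hκ) ((Equiv.ofInjective ι hι).symm ⟨ι i, ⟨i, rfl⟩⟩) : τ) = κ i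
    rw [Equiv.ofInjective_symm_apply]
    rfl
  have hre : rename κ p = rename π (rename ι p) := by
    rw [rename_rename]
    exact congrArg (fun φ : σ → τ => rename φ p) (funext fun i => (hπ i).symm)
  have hdet : (Equiv.Perm.permMatrix k π.symm).det ≠ 0 := by
    rw [Matrix.det_permutation]
    rcases Int.units_eq_one_or (Equiv.Perm.sign π.symm) with h | h <;> simp [h]
  refine ⟨Matrix.GeneralLinearGroup.mkOfDetNeZero _ hdet, ?_⟩
  dsimp only
  rw [linSubstRep_apply, Matrix.GeneralLinearGroup.val_mkOfDetNeZero, hre, linSubst_permMatrix,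
    Equiv.symm_symm]

end Transport

end Summit.ValiantsHypothesis.ValiantsHypothesis.Theorems.GenInheritance
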